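import Mathlib
import Literature.Analysis.FluidPDE.LocalPressureOscillationScaling
import Summits.NavierStokesRegularity.NavierStokesRegularity.Theorems.SqueezeCycleSingularZoom
import Summits.NavierStokesRegularity.NavierStokesRegularity.Theses.OneComponentPincer
import HarnessLib

/-!
# `OneComponentPincer.TypeIZoomWithComponent` — the singular Type-I zoom carrying one
# component in `L³` (item stmt-NavierStokesRegularity-19558)

**Statement.** K1 (the one-component Type-I Liouville statement, inlined: every member of the
Type-I model class `𝒦_C` — smooth divergence-free KNSS-mild ancient fields with the Type-I rate and
scale-invariant local energies `≤ C` — one of whose Cartesian components is bounded in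
`L^∞_t L³_x(ℝ³)` is bounded near the apex) implies: a finite-energy classical Leray–Hopf solution
from a rapidly decaying datum with the Type-I rate at `T`, every point `x₀` of which carries a unit
`e`, a radius `ρ` and a bound `sup_{[0,T)} ‖u(t) · e‖_{L³(B(x₀, ρ))} < ∞`, extends smoothly past
`T`.

PROOF. Exactly the tree's `SqueezeCycle.SingularZoom` argument (`singularZoom_zoomLimit`,
`singularZoom_of_zoomLimit`: Lemarié-Rieusset 2016 Thm. 15.1 (C) produces a backward singular point
`(T, x₀)` if `u` does not extend; the viscosity-normalising zooms at `(T, x₀)` converge along a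
subsequence to a member of `𝒦_C` unbounded at the origin) plus ONE Fatou clause
(`TypeIZoomWithComponent.eLpNorm_inner_le_of_zoom_limit`): `L³` scale invariance in dimension three
makes the truncated zoomed components `𝟙 ⟪c_kα u(T + c_k²β t, x₀ + c_kR y), e⟫` have `L³(ℝ³)` norm
`(α/R) ‖u(·) · e‖_{L³(B(x₀,ρ))} ≤ (α/R) M` (`map_space_affine_volume_restrict_preimage`), they
converge pointwise to `⟪ū(t), e⟫` (the balls `B(0, ρ/(c_kR))` exhaust `ℝ³`), and Fatou for
`eLpNorm` (`Lp.eLpNorm_lim_le_liminf_eLpNorm`) bounds `‖ū(t) · e‖_{L³(ℝ³)} ≤ (α/R) M` for every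
`t < 0`; K1 then forbids the singular apex.

HONEST FRAMING: a conditional lemma (K1 is an open Liouville-type statement taken as hypothesis)
about HYPOTHETICAL Type-I blow-up solutions (other route, not a pub-ns-dss cell file); nothing here
bears on the regularity problem itself.

References: Albritton–Barker 2019, §3; Koch–Nadirashvili–Seregin–Šverák 2009, §6 Lemma 6.1;
Lemarié-Rieusset 2016, Thm. 15.1. [AlbrittonBarker2019] [KochNadirashviliSereginSverak2009]
[LemarieRieusset2016]
-/

noncomputable section

set_option linter.dupNamespace false

namespace Summit.NavierStokesRegularity.NavierStokesRegularity.Theorems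

open MeasureTheory Set Function Filter Topology TopologicalSpace Metric
open scoped NNReal ENNReal RealInnerProductSpace
open Literature.Analysis Literature.Analysis.FluidPDE

namespace TypeIZoomWithComponent

/-- `L³` scale invariance in dimension three, as an identity of the scaling factors:
`b · (b³)^{-1/3} = 1` for `b > 0`. [folklore] -/
theorem ofReal_mul_ofReal_inv_cube_rpow {b : ℝ} (hb : 0 < b) :
    ENNReal.ofReal b * ENNReal.ofReal ((b ^ 3)⁻¹) ^ (1 / (3 : ℝ≥0∞)).toReal = 1 := by
  have ht : (1 / (3 : ℝ≥0∞)).toReal = 1 / 3 := by rw [ENNReal.toReal_div]; norm_num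
  rw [ht, ENNReal.ofReal_rpow_of_nonneg (by positivity) (by norm_num), ← ENNReal.ofReal_mul hb.le]
  have h1 : ((b ^ 3)⁻¹) ^ (1 / 3 : ℝ) = b⁻¹ := by
    rw [Real.inv_rpow (by positivity)]
    congr 1
    rw [show (1 / 3 : ℝ) = ((3 : ℕ) : ℝ)⁻¹ by norm_num]
    exact Real.pow_rpow_inv_natCast hb.le three_ne_zero
  rw [h1, mul_inv_cancel₀ hb.ne', ENNReal.ofReal_one]

/-- **The `L³` norm of a truncated zoomed component**: for `b > 0`, `a ≥ 0`,
`‖y ↦ ⟪a F(x₀ + b y), e⟫‖_{L³({x₀ + b y ∈ B(x₀,ρ)})} = a (b³)^{-1/3} ‖⟪F, e⟫‖_{L³(B(x₀,ρ))}`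
(push-forward of Lebesgue measure under the affine zoom). [folklore] -/
theorem eLpNorm_inner_zoom_slice_restrict (F : EuclideanSpace ℝ (Fin 3) → EuclideanSpace ℝ (Fin 3))
    (x₀ e : EuclideanSpace ℝ (Fin 3)) {a b : ℝ} (ha : 0 ≤ a) (hb : 0 < b) (ρ : ℝ) :
    eLpNorm (fun y => ⟪a • F (x₀ + b • y), e⟫) 3
        (volume.restrict ((fun y : EuclideanSpace ℝ (Fin 3) => x₀ + b • y) ⁻¹' ball x₀ ρ)) =
      ENNReal.ofReal a * (ENNReal.ofReal ((b ^ 3)⁻¹) ^ (1 / (3 : ℝ≥0∞)).toReal *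
        eLpNorm (fun x => ⟪F x, e⟫) 3 (volume.restrict (ball x₀ ρ))) := by
  -- pull out the amplitude `a`
  have h1 : (fun y => ⟪a • F (x₀ + b • y), e⟫) = a • fun y => ⟪F (x₀ + b • y), e⟫ := by
    funext y
    simp only [Pi.smul_apply, smul_eq_mul, real_inner_smul_left]
  rw [h1, eLpNorm_const_smul, Real.enorm_eq_ofReal ha]
  congr 1
  -- change of variables `x = x₀ + b y`
  have hme : MeasurableEmbedding (fun y : EuclideanSpace ℝ (Fin 3) => x₀ + b • y) := by
    have h := (spaceAffineHomeomorph hb.ne' x₀).measurableEmbedding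
    rwa [coe_spaceAffineHomeomorph] at h
  have h2 := hme.eLpNorm_map_measure (g := fun x => ⟪F x, e⟫) (p := 3)
    (μ := volume.restrict ((fun y : EuclideanSpace ℝ (Fin 3) => x₀ + b • y) ⁻¹' ball x₀ ρ))
  rw [map_space_affine_volume_restrict_preimage hb x₀, finrank_euclideanSpace_fin,
    eLpNorm_smul_measure_of_ne_top (by norm_num), smul_eq_mul] at h2
  rw [show (fun y => ⟪F (x₀ + b • y), e⟫) = (fun x => ⟪F x, e⟫) ∘ fun y => x₀ + b • y from rfl, ← h2]

/-- **The one-component `L³` bound passes to zoom limits** (module docstring): slices `F_j` with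
`‖⟪F_j, e⟫‖_{L³(B(x₀, ρ))} ≤ M`, zoomed slices `y ↦ a_j F_j(x₀ + b_j y)` (`a_j = L b_j`, `L ≥ 0`,
`b_j > 0`, `b_j → 0`) converging pointwise to `g`, `F_j` continuous: then
`‖⟪g, e⟫‖_{L³(ℝ³)} ≤ L · M`. [folklore] -/
theorem eLpNorm_inner_le_of_zoom_limit
    {F : ℕ → EuclideanSpace ℝ (Fin 3) → EuclideanSpace ℝ (Fin 3)}
    {g : EuclideanSpace ℝ (Fin 3) → EuclideanSpace ℝ (Fin 3)} {x₀ e : EuclideanSpace ℝ (Fin 3)}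
    {a b : ℕ → ℝ} {L ρ : ℝ} {M : ℝ≥0∞}
    (hFc : ∀ j, Continuous (F j)) (hb : ∀ j, 0 < b j) (hab : ∀ j, a j = L * b j) (hL : 0 ≤ L)
    (hb0 : Tendsto b atTop (𝓝 0)) (hρ : 0 < ρ)
    (hbound : ∀ j, eLpNorm (fun x => ⟪F j x, e⟫) 3 (volume.restrict (ball x₀ ρ)) ≤ M)
    (hlim : ∀ y, Tendsto (fun j => a j • F j (x₀ + b j • y)) atTop (𝓝 (g y))) :
    eLpNorm (fun y => ⟪g y, e⟫) 3 volume ≤ ENNReal.ofReal L * M := by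
  have ha : ∀ j, 0 ≤ a j := fun j => by rw [hab]; exact mul_nonneg hL (hb j).le
  -- the truncated zoomed components
  set S : ℕ → Set (EuclideanSpace ℝ (Fin 3)) :=
    fun j => (fun y : EuclideanSpace ℝ (Fin 3) => x₀ + b j • y) ⁻¹' ball x₀ ρ with hS
  have hSmeas : ∀ j, MeasurableSet (S j) := fun j =>
    (isOpen_ball.preimage (by fun_prop)).measurableSet
  set f : ℕ → EuclideanSpace ℝ (Fin 3) → ℝ :=
    fun j => (S j).indicator fun y => ⟪a j • F j (x₀ + b j • y), e⟫ with hf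
  have hfm : ∀ j, AEStronglyMeasurable (f j) volume := fun j => by
    refine AEStronglyMeasurable.indicator ?_ (hSmeas j)
    exact (((hFc j).comp (by fun_prop)).const_smul (a j)).inner continuous_const
      |>.aestronglyMeasurable
  -- pointwise convergence of the truncated components to `⟪g, e⟫`
  have hflim : ∀ y, Tendsto (fun j => f j y) atTop (𝓝 ⟪g y, e⟫) := by
    intro y
    have hev : ∀ᶠ j in atTop, y ∈ S j := by
      have h1 : Tendsto (fun j => b j * ‖y‖) atTop (𝓝 (0 * ‖y‖)) := hb0.mul_const _
      rw [zero_mul] at h1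
      filter_upwards [h1.eventually (gt_mem_nhds hρ)] with j hj
      show x₀ + b j • y ∈ ball x₀ ρ
      rw [mem_ball, dist_eq_norm, add_sub_cancel_left, norm_smul, Real.norm_eq_abs,
        abs_of_pos (hb j)]
      exact hj
    refine ((hlim y).inner tendsto_const_nhds).congr' ?_
    filter_upwards [hev] with j hj
    simp only [hf, indicator_of_mem hj]
  -- Fatou for `eLpNorm`
  have hFatou := Lp.eLpNorm_lim_le_liminf_eLpNorm (p := (3 : ℝ≥0∞)) hfm (fun y => ⟪g y, e⟫)
    (Eventually.of_forall hflim)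
  refine hFatou.trans ?_
  -- each truncated norm is at most `L M`
  have hle : ∀ j, eLpNorm (f j) 3 volume ≤ ENNReal.ofReal L * M := by
    intro j
    rw [hf, eLpNorm_indicator_eq_eLpNorm_restrict (hSmeas j), hS,
      eLpNorm_inner_zoom_slice_restrict (F j) x₀ e (ha j) (hb j) ρ, ← mul_assoc, hab, ENNReal.ofReal_mul hL,
      mul_assoc (ENNReal.ofReal L), ofReal_mul_ofReal_inv_cube_rpow (hb j), mul_one]
    have h := hbound j
    gcongr
  exact liminf_le_of_frequently_le' ((Eventually.of_forall hle).frequently)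

end TypeIZoomWithComponent

namespace TypeIZoomWithComponent

-- adapted from `singularZoom_zoomLimit` (Theorems/SqueezeCycleSingularZoom.lean): the same zoom,
-- with the one-component clause carried through the extraction
/-- **The singular Type-I zoom limit WITH ONE COMPONENT IN `L³`.** At a backward singular final-time
point `(T, x₀)` of a classical Leray–Hopf solution from a rapidly decaying datum with the Type-I
rate, whose component `u · e` is bounded in `L³(B(x₀, ρ))` uniformly on `[0, T)`, the singular
Type-I zoom limit `ū ∈ 𝒦_C` of `singularZoom_zoomLimit` (Type-I KNSS-mild ancient field with
scale-invariant energies `≤ C`, unbounded at the origin) can be taken with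
`sup_{t<0} ‖ū(t) · e‖_{L³(ℝ³)} < ∞` (`L³` scale invariance and Fatou along the zoom,
`eLpNorm_inner_le_of_zoom_limit`). [cite: AlbrittonBarker2019, §3; KochNadirashviliSereginSverak2009, Lemma 6.1 (arXiv:0709.3599 p. 11)] -/
theorem zoomLimit_component {ν T : ℝ} (hν : 0 < ν) (hT : 0 < T)
    {u : ℝ → EuclideanSpace ℝ (Fin 3) → EuclideanSpace ℝ (Fin 3)}
    {p : ℝ → EuclideanSpace ℝ (Fin 3) → ℝ}
    (hsol : IsClassicalNSSolutionOn (Ico 0 T) ν 0 u p) (hLH : IsLerayHopfOn T ν 0 (u 0) u)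
    (hdec : HasRapidSpatialDecay (u 0)) (hTI : IsTypeIBlowup u T) (x₀ : EuclideanSpace ℝ (Fin 3))
    (hsing : ∀ r : ℝ, 0 < r →
      eLpNorm (uncurry u) ∞ (volume.restrict (parabolicCylinder r ((T : ℝ), x₀))) = ∞)
    {e : EuclideanSpace ℝ (Fin 3)} {ρ : ℝ} (hρ : 0 < ρ) {M : ℝ≥0∞} (hM : M < ⊤)
    (hK3 : ∀ t ∈ Ico 0 T, eLpNorm (fun x => ⟪u t x, e⟫) 3 (volume.restrict (ball x₀ ρ)) ≤ M) :
    ∃ (C : ℝ) (ū : ℝ → EuclideanSpace ℝ (Fin 3) → EuclideanSpace ℝ (Fin 3)),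
      IsTypeIAncientMild C ū ∧
      (∀ (x₁ : EuclideanSpace ℝ (Fin 3)) (t₀ r : ℝ), t₀ ≤ 0 → 0 < r →
        (∀ t, t₀ - r ^ 2 < t → t < t₀ → r⁻¹ * ∫ x in ball x₁ r, ‖ū t x‖ ^ 2 ≤ C) ∧
        r⁻¹ * ∫ t in Ioo (t₀ - r ^ 2) t₀, ∫ x in ball x₁ r, ‖fderiv ℝ (ū t) x‖ ^ 2 ≤ C) ∧
      (∀ r > 0, ∀ M : ℝ, ∃ t ∈ Ioo (-(r ^ 2)) (0 : ℝ),
        ∃ x ∈ ball (0 : EuclideanSpace ℝ (Fin 3)) r, M < ‖ū t x‖) ∧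
      ∃ M' : ℝ≥0∞, M' < ⊤ ∧ ∀ t < 0, eLpNorm (fun x => ⟪ū t x, e⟫) 3 volume ≤ M' := by
  -- ## (1) the Type-I rate window, the Morrey bound and the unit zoom at `(T, x₀)`
  obtain ⟨C, δ, -, hδ, hδT, hrate⟩ := exists_typeI_rate_window hT hTI
  obtain ⟨r₀, M₀, T₁, hr₀, hT₁, hMor⟩ := morrey_of_typeI hν hT hsol hLH hTI
  obtain ⟨R, α, β, hR, hα, hβ, hβeq, hαeq, hβT, hball, hGv, htypeI⟩ :=
    exists_zoom_typeIBound_lt_top_of_morrey hν hT hsol hLH hr₀ hT₁ hMor x₀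
  set v : ℝ → EuclideanSpace ℝ (Fin 3) → EuclideanSpace ℝ (Fin 3) := α • stPull β R T x₀ u with hv
  set πv : ℝ → EuclideanSpace ℝ (Fin 3) → ℝ :=
    α ^ 2 • stPull β R T x₀ (fun t x => p t x - (p t 0 - normalisedPressure (u t) 0)) with hπv
  set Gv : ℝ → EuclideanSpace ℝ (Fin 3) → EuclideanSpace ℝ (Fin 3) →L[ℝ] EuclideanSpace ℝ (Fin 3) :=
    (α * R) • stPull β R T x₀ (fun t x => fderiv ℝ (u t) x) with hGvdef
  set I₀ : ℝ≥0∞ := typeIBound (parabolicCylinder (1 / 2) (0 : ℝ × EuclideanSpace ℝ (Fin 3))) v πv Gv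
    with hI₀
  have hI₀top : I₀ ≠ ⊤ := htypeI.ne
  -- ## (2) the scales `c k = 1/(k+4) ↓ 0` and the zoom sequence
  set c : ℕ → ℝ := fun k => 1 / ((k : ℝ) + 4) with hc
  have hcpos : ∀ k, 0 < c k := fun k => by simp only [hc]; positivity
  have hc4 : ∀ k, c k ≤ 1 / 4 := fun k =>
    div_le_div_of_nonneg_left zero_le_one (by norm_num) (by linarith [(Nat.cast_nonneg k : (0 : ℝ) ≤ k)])
  have hc2 : ∀ k, c k ≤ 1 / 2 := fun k => (hc4 k).trans (by norm_num)
  have hclim : Tendsto c atTop (𝓝 0) :=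
    tendsto_const_nhds.div_atTop (tendsto_atTop_add_const_right _ _ tendsto_natCast_atTop_atTop)
  set w : ℕ → ℝ → EuclideanSpace ℝ (Fin 3) → EuclideanSpace ℝ (Fin 3) :=
    fun k => (c k * α) • stPull (c k ^ 2 * β) (c k * R) T x₀ u with hw
  -- the final windows `(A k, 0)`, `A k → -∞`
  set A : ℕ → ℝ := fun k => -(δ / (c k ^ 2 * β)) with hA
  have hAk : ∀ k, A k = -(δ / β * ((k : ℝ) + 4) ^ 2) := by
    intro k
    simp only [hA, hc]
    field_simp
  have hAlim : Tendsto A atTop atBot := by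
    have h1 : Tendsto (fun k : ℕ => ((k : ℝ) + 4) ^ 2) atTop atTop :=
      (tendsto_pow_atTop two_ne_zero).comp
        (tendsto_atTop_add_const_right _ _ tendsto_natCast_atTop_atTop)
    have h2 : Tendsto (fun k : ℕ => δ / β * ((k : ℝ) + 4) ^ 2) atTop atTop :=
      h1.const_mul_atTop (by positivity)
    refine (tendsto_neg_atTop_atBot.comp h2).congr fun k => ?_
    rw [hAk k]
    rfl
  -- ## (3) per-scale facts
  have hcW : ∀ k, ContinuousOn (uncurry (w k)) (Ioo (A k) 0 ×ˢ univ) := fun k =>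
    zoom_continuousOn hν hsol hR hαeq hβeq (hcpos k) hδT
  have hdivW : ∀ k, ∀ t ∈ Ioo (A k) 0, IsWeaklyDivFree (w k t) := fun k t ht =>
    zoom_isWeaklyDivFree hν hsol hR hαeq hβeq (hcpos k) hδT ht
  have hmildW : ∀ k, ∀ s t : ℝ, A k < s → s < t → t < 0 → ∀ y,
      w k t y = UnboundedOperators.heatExtension (w k s) (t - s) y -
        oseenDuhamel 1 s (w k) (w k) t y := fun k s t hs hst ht y =>
    zoom_oseen hν hT hsol hLH hdec hR hαeq hβeq (hcpos k) hδT hs hst ht y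
  set C₁ : ℝ := α * C / Real.sqrt β with hC₁
  have hIW : ∀ k, ∀ t ∈ Ioo (A k) 0, ∀ y, ‖w k t y‖ ≤ C₁ / Real.sqrt (-t) := fun k t ht y =>
    zoom_norm_le hR hαeq hβeq hν (hcpos k) hδT hrate ht y
  -- ## (4) extraction of the `C¹_loc` limit `W ∈ 𝒦_{C₁}`
  obtain ⟨φ, hφ, W, hWclass, hpt, hptG, -, -⟩ :=
    exists_tendsto_of_typeI_seq_Ioo C₁ hAlim hcW hdivW hmildW hIW
  have hφt : Tendsto φ atTop atTop := hφ.tendsto_atTop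
  have hcφ : Tendsto (fun j => c (φ j)) atTop (𝓝 0) := hclim.comp hφt
  have hAφ : Tendsto (fun j => A (φ j)) atTop atBot := hAlim.comp hφt
  -- ## (5) the scale-invariant energies of `W`
  set B : ℝ := max (α ^ 2 * M₀ / R ^ 2) I₀.toReal with hB
  have hB0 : 0 ≤ B := le_max_of_le_right ENNReal.toReal_nonneg
  have henA : ∀ (x₁ : EuclideanSpace ℝ (Fin 3)) (t : ℝ), t < 0 → ∀ r : ℝ, 0 < r →
      ∀ᶠ j in atTop, r⁻¹ * ∫ y in ball x₁ r, ‖w (φ j) t y‖ ^ 2 ≤ B := by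
    intro x₁ t ht r hr
    have e1 : ∀ᶠ j in atTop, c (φ j) * R * r < r₀ := by
      have h : Tendsto (fun j => c (φ j) * R * r) atTop (𝓝 (0 * R * r)) :=
        (hcφ.mul_const R).mul_const r
      rw [zero_mul, zero_mul] at h
      exact h.eventually_lt_const hr₀
    have e2 : ∀ᶠ j in atTop, T₁ < T + c (φ j) ^ 2 * β * t := by
      have h : Tendsto (fun j => T + c (φ j) ^ 2 * β * t) atTop (𝓝 (T + 0 ^ 2 * β * t)) :=
        (((hcφ.pow 2).mul_const β).mul_const t).const_add T
      rw [zero_pow two_ne_zero, zero_mul, zero_mul, add_zero] at h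
      exact h.eventually_const_lt hT₁
    filter_upwards [e1, e2] with j hj1 hj2
    have hpos : 0 < c (φ j) ^ 2 * β := by positivity
    have hlt : T + c (φ j) ^ 2 * β * t < T := by nlinarith
    exact (zoom_scaledEnergy_le hR (hcpos (φ j)) hMor ⟨hj2, hlt⟩ x₁ hr hj1.le).trans (le_max_left _ _)
  have henE : ∀ (x₁ : EuclideanSpace ℝ (Fin 3)) (t₀ r : ℝ), t₀ < 0 → 0 < r →
      ∀ᶠ j in atTop,
        r⁻¹ * ∫ t in Ioo (t₀ - r ^ 2) t₀, ∫ y in ball x₁ r, ‖fderiv ℝ (w (φ j) t) y‖ ^ 2 ≤ B := by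
    intro x₁ t₀ r ht₀ hr
    have e1 : ∀ᶠ j in atTop, A (φ j) < t₀ - r ^ 2 - 1 := hAφ.eventually (eventually_lt_atBot _)
    have e2 : ∀ᶠ j in atTop, c (φ j) ^ 2 * (r ^ 2 - t₀) < 1 / 4 := by
      have h : Tendsto (fun j => c (φ j) ^ 2 * (r ^ 2 - t₀)) atTop (𝓝 (0 ^ 2 * (r ^ 2 - t₀))) :=
        (hcφ.pow 2).mul_const _
      rw [zero_pow two_ne_zero, zero_mul] at h
      exact h.eventually_lt_const (by norm_num)
    have e3 : ∀ᶠ j in atTop, c (φ j) * (‖x₁‖ + r) < 1 / 2 := by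
      have h : Tendsto (fun j => c (φ j) * (‖x₁‖ + r)) atTop (𝓝 (0 * (‖x₁‖ + r))) :=
        hcφ.mul_const _
      rw [zero_mul] at h
      exact h.eventually_lt_const (by norm_num)
    filter_upwards [e1, e2, e3] with j hj1 hj2 hj3
    exact (zoom_gradEnergy_le (x₀ := x₀) (πv := πv) hν hsol hR hαeq hβeq (hcpos (φ j)) hδT hI₀top ht₀ hr
      (by linarith) hj2.le hj3.le).trans (le_max_right _ _)
  have hen := energyBounds_of_tendsto_Ioo C₁ hB0 hAφ (w := fun j => w (φ j))
    (fun j => hcW (φ j)) (fun j => hdivW (φ j)) (fun j => hmildW (φ j)) (fun j => hIW (φ j))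
    henA henE hWclass hpt hptG
  -- ## (6) `W` is unbounded at the origin
  have hsingW : ∀ r > 0, ∀ M : ℝ, ∃ t ∈ Ioo (-(r ^ 2)) (0 : ℝ),
      ∃ x ∈ ball (0 : EuclideanSpace ℝ (Fin 3)) r, M < ‖W t x‖ :=
    zoomSeq_unbounded_at_origin (πv := πv) hsol hR hα hβ hβT hsing hball hGv hI₀top
      (fun j => hcpos (φ j)) (fun j => hc2 (φ j)) fun z hz =>
        hpt z.1 ((SuitableCompactness.mem_parabolicCylinder_zero.1 hz).1.2) z.2
  -- ## (6b) the one-component bound of `W` (the new clause)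
  have hcomp : ∀ t < 0, eLpNorm (fun y => ⟪W t y, e⟫) 3 volume ≤ ENNReal.ofReal (α / R) * M := by
    intro t ht
    -- the tail where the window contains `t`
    obtain ⟨N, hN⟩ := eventually_atTop.1 (hAφ.eventually (eventually_lt_atBot t))
    have hmem : ∀ i, t ∈ Ioo (A (φ (i + N))) 0 := fun i => ⟨hN _ (Nat.le_add_left N i), ht⟩
    have hphys : ∀ i, T + c (φ (i + N)) ^ 2 * β * t ∈ Ico 0 T := fun i => by
      have h := (zoom_time_mem (T := T) (hcpos (φ (i + N))) hβ hδT (hmem i)).1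
      exact ⟨by linarith [h.1], h.2⟩
    refine eLpNorm_inner_le_of_zoom_limit
      (F := fun i => u (T + c (φ (i + N)) ^ 2 * β * t)) (a := fun i => c (φ (i + N)) * α)
      (b := fun i => c (φ (i + N)) * R) (L := α / R) (x₀ := x₀)
      (fun i => (hsol.contDiff_velocity (hphys i)).continuous)
      (fun i => mul_pos (hcpos _) hR) (fun i => by field_simp) (by positivity)
      ?_ hρ (fun i => hK3 _ (hphys i)) (fun y => ?_)
    · have h : Tendsto (fun i => c (φ (i + N)) * R) atTop (𝓝 (0 * R)) :=
        (hcφ.comp (tendsto_add_atTop_nat N)).mul_const R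
      rwa [zero_mul] at h
    · have h := (hpt t ht y).comp (tendsto_add_atTop_nat N)
      refine h.congr fun i => ?_
      show w (φ (i + N)) t y = _
      simp only [hw, smul_stPull_apply]
  -- ## (7) one constant for the rate and the energies
  refine ⟨max C₁ B, W, ?_, ?_, hsingW, ENNReal.ofReal (α / R) * M,
    ENNReal.mul_lt_top ENNReal.ofReal_lt_top hM, hcomp⟩
  · exact ⟨hWclass.1, hWclass.2.1, hWclass.2.2.1, fun t ht x =>
      (hWclass.norm_le ht x).trans
        (div_le_div_of_nonneg_right (le_max_left _ _) (Real.sqrt_nonneg _))⟩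
  · intro x₁ t₀ r ht₀ hr
    obtain ⟨h1, h2⟩ := hen x₁ t₀ r ht₀ hr
    exact ⟨fun t ht1 ht2 => (h1 t ht1 ht2).trans (le_max_right _ _), h2.trans (le_max_right _ _)⟩

end TypeIZoomWithComponent

-- adapted from `singularZoom_of_zoomLimit` (Theorems/SqueezeCycleSingularZoomReduction.lean)
open TypeIZoomWithComponent in
/-- **`OneComponentPincer.TypeIZoomWithComponent`** (item stmt-NavierStokesRegularity-19558, module
docstring): the one-component Type-I Liouville statement K1 implies that a Type-I Leray–Hopf blow-up
with the local one-component bounds of K3 extends smoothly. [cite: LemarieRieusset2016, Thm 15.1 (C); AlbrittonBarker2019, §3] -/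
theorem oneComponentPincer_typeIZoomWithComponent_proof :
    Theses.OneComponentPincer.TypeIZoomWithComponent := by
  intro hK1 ν T hν hT u p hcl hLH hdec hTI hK3
  apply hasSmoothExtensionPast_of_forall_exists_parabolicCylinder hν hT hcl hLH hdec
  intro x₀
  by_contra hno
  push Not at hno
  have hsing : ∀ r : ℝ, 0 < r →
      eLpNorm (uncurry u) ∞ (volume.restrict (parabolicCylinder r ((T : ℝ), x₀))) = ∞ :=
    fun r hr => top_le_iff.1 (hno r hr)
  obtain ⟨e, he, ρ, hρ, M, hM, hbound⟩ := hK3 x₀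
  obtain ⟨C, ū, hmild, hAE, hs, M', hM', hcomp⟩ :=
    zoomLimit_component hν hT hcl hLH hdec hTI x₀ hsing hρ hM hbound
  obtain ⟨h1, h2, h3, h4⟩ := (isTypeIAncientMild_iff).1 hmild
  exact hK1 C ū ⟨h1, h2, fun s t hst ht x => h3 s t hst ht x, h4, hAE⟩ ⟨e, he, M', hM', hcomp⟩ hs

end Summit.NavierStokesRegularity.NavierStokesRegularity.Theorems

end
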